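import Literature.Barriers.SmoothPoincare4.ExoticContractibleTheoremAProofs
import Literature.Topology.FourManifolds.CobordismEndDiffeotopy
import Literature.Topology.FourManifolds.CobordismEndFlattening
import Literature.Topology.FourManifolds.CobordismAttachmentPasting
import Literature.Topology.FourManifolds.DiffeotopyProofs
import Literature.Topology.FourManifolds.IsotopyExtensionBoundarylessManifold
import HarnessLib

/-!
# Akbulut–Ruberman 2016, §3: the boundary symmetries of `V′ = W ∪_f X` all extend (discharge)

Sibling proof file of `Literature/Barriers/SmoothPoincare4/ExoticContractibleTheoremAProofs.lean`
(fact seat of the tree's barrier `Literature.Barriers.SmoothPoincare4.ContractibleBarrierFour`,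
descended to the leaf `akbulutRuberman2016_boundaryDiffeosExtend` of the DAG of Akbulut–Ruberman's
Thm. A).  Everything here is PROVED; no definitions, no named facts.

* `Literature.Barriers.SmoothPoincare4.akbulutRuberman2016_boundaryDiffeosExtend_holds` —
  **discharge of the named fact `akbulutRuberman2016_boundaryDiffeosExtend`** (part (S) of the
  printed proof of Thm. A, S. Akbulut, D. Ruberman, *Absolutely exotic compact 4-manifolds*,
  Comment. Math. Helv. 91 (2016), §3: "By the claim above and Lemma 1.2, there is no
  diffeomorphism between `V` and `V′`"; §2: "we will choose `N` carefully so that all of its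
  self-diffeomorphisms extend over `V′`").  Statement: if the cobordism `X` from `∂W` to `N` has
  the extension property of the Claim (`FarEndDiffeosExtend X`: every `g ∈ Diff N` extends to a
  `G ∈ Diff X` with `G ∘ inr = inr ∘ g′`, `G ∘ inl = inl ∘ k`, `g′` isotopic to `g`, `k` isotopic
  to `id`), then for every witness `A′` of `V′ = W ∪_f X` every `g ∈ Diff (∂V′ = N)` extends to a
  self-diffeomorphism of `V′`.

## The proof (the "standard steps implicit in print")

Given `g`, take `G`, `g′`, `k` from the Claim.

1. *Isotopies to diffeotopies.*  `N` and `∂W` are closed `3`-manifolds (compact: ends of the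
   compact cobordism; boundaryless), so by the isotopy extension theorem of the tree
   (`Diffeomorph.isIsotopic_iff_isAmbientIsotopic_holds`, Hirsch (1976), Ch. 8, Thm. 1.3) the
   isotopies `g′ ≃ g`, `k ≃ id` are ambient, and the diffeomorphisms `g′⁻¹ g` and `k⁻¹` are
   diffeotopic to the identity (`AmbientIsotopy.isDiffeotopicToId`, `DiffeotopyProofs.lean`).
2. *Absorbing the isotopies in a collar of `∂X`* (`Cobordism.exists_diffeomorph_apply_inl_apply_inr`,
   `CobordismEndDiffeotopy.lean`; Hirsch, Ch. 8 §2, proof of Thm. 2.3): there is `Θ ∈ Diff X`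
   with `Θ ∘ inl = inl ∘ k⁻¹`, `Θ ∘ inr = inr ∘ g′⁻¹ g`; then `G″ = Θ ∘ G` satisfies
   `G″ ∘ inr = inr ∘ g` and fixes `inl (∂W)` pointwise.
3. *Flattening near `∂W`* (`Cobordism.exists_diffeomorph_flatten_inl`,
   `CobordismEndFlattening.lean`; uniqueness of collars, Bröcker–Jänich (13.7)): there is
   `Ψ ∈ Diff X` fixing `inr N` pointwise with `Ψ ∘ G″ = id` near `inl (∂W)`; so `G₂ = Ψ ∘ G″`
   is the identity near `inl (∂W)` and `G₂ ∘ inr = inr ∘ g`.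
4. *Pasting with the identity of `W`* (`CobordismAttachment.exists_diffeomorph_apply_jX_eq`,
   `CobordismAttachmentPasting.lean`; Milnor (1965), Thm. 1.4): `G₂ ∪ id_W` is a
   self-diffeomorphism `Ĝ` of `V′` with `Ĝ ∘ jX = jX ∘ G₂`, whence
   `Ĝ ∘ (jX ∘ inr) = (jX ∘ inr) ∘ g`, i.e. `Ĝ` extends `g` on `∂V′ = N`.

## References

* S. Akbulut, D. Ruberman, *Absolutely exotic compact 4-manifolds*, Comment. Math. Helv. 91
  (2016) 1–19, §§2–3 (proof of Thm. A). [AkbulutRuberman2016]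
* M. W. Hirsch, *Differential Topology*, GTM 33 (1976), Ch. 8 §§1–2. [HirschDT1976]
* Th. Bröcker, K. Jänich, *Introduction to Differential Topology* (1982), (13.7). [BrockerJanich1982]
* J. Milnor, *Lectures on the h-cobordism theorem* (1965), §1, Thm. 1.4. [MilnorHCobordism1965]
-/

noncomputable section

open scoped Manifold ContDiff
open Function Set
open Literature.Topology.FourManifolds

namespace Literature.Barriers.SmoothPoincare4

universe u

/-! ### Step 1: isotopies of diffeomorphisms of a closed manifold give diffeotopies -/

section Isotopy

variable {N : Type u} [TopologicalSpace N] [ChartedSpace (EuclideanSpace ℝ (Fin 3)) N]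
  [IsManifold (𝓡 3) ∞ N] [CompactSpace N] [T2Space N]

/-- On a closed `3`-manifold, if `g′` is isotopic to `g` then `g′⁻¹ g` is diffeotopic to the
identity: the isotopy is ambient (`Diffeomorph.isIsotopic_iff_isAmbientIsotopic_holds`, isotopy
extension), `F₁ ∘ g′ = g`, and the stage `F₁ = g′⁻¹ g` of an ambient isotopy is diffeotopic to the
identity (`AmbientIsotopy.isDiffeotopicToId`). [cite: HirschDT1976, Ch. 8 §1, Thm. 1.3 and p. 178] -/
theorem isDiffeotopicToId_symm_trans_of_isIsotopic {g' g : N ≃ₘ⟮𝓡 3, 𝓡 3⟯ N}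
    (h : Literature.Topology.FourManifolds.Diffeomorph.IsIsotopic g' g) :
    Literature.Topology.FourManifolds.Diffeomorph.IsDiffeotopicToId (g'.symm.trans g) := by
  obtain ⟨F, hF⟩ := (Diffeomorph.isIsotopic_iff_isAmbientIsotopic_holds (J := 𝓡 3) (N := N)).1 h
  have hF1 : F.toDiffeomorph 1 = g'.symm.trans g := by
    refine Diffeomorph.ext fun y => ?_
    have h1 : F.toFun 1 (g' (g'.symm y)) = g (g'.symm y) := congrFun hF (g'.symm y)
    rw [Diffeomorph.apply_symm_apply] at h1
    rw [AmbientIsotopy.coe_toDiffeomorph, Diffeomorph.coe_trans, comp_apply]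
    exact h1
  rw [← hF1]
  exact F.isDiffeotopicToId 1

/-- On a closed `3`-manifold, if `k` is isotopic to the identity then `k⁻¹` is diffeotopic to
the identity. [cite: HirschDT1976, Ch. 8 §1, Thm. 1.3 and p. 178] -/
theorem isDiffeotopicToId_symm_of_isIsotopic_refl {k : N ≃ₘ⟮𝓡 3, 𝓡 3⟯ N}
    (h : Literature.Topology.FourManifolds.Diffeomorph.IsIsotopic k (Diffeomorph.refl (𝓡 3) N ∞)) :
    Literature.Topology.FourManifolds.Diffeomorph.IsDiffeotopicToId k.symm := by
  have h' := isDiffeotopicToId_symm_trans_of_isIsotopic h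
  rwa [Diffeomorph.trans_refl] at h'

end Isotopy

/-! ### Steps 2–4: the discharge -/

/-- **Akbulut–Ruberman 2016, §3, part (S): the boundary symmetries of `V′ = W ∪_f X` all extend
— discharge of the named fact `akbulutRuberman2016_boundaryDiffeosExtend`.**  If the cobordism
`X` from `∂W` to `N` has the extension property of the Claim (`FarEndDiffeosExtend X`), then for
every witness `A′ : CobordismAttachment b X f V′` and every `g ∈ Diff N`,
`ExtendsToDiffeomorph A′.boundaryData g`.  Proof (module docstring): absorb the two isotopies of
the Claim in a collar of `∂X` (isotopy extension on the closed `3`-manifolds `N`, `∂W`, then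
Hirsch's spreading of a diffeotopy over a collar), flatten the resulting diffeomorphism of `X`
to the identity near `∂W` by the uniqueness of collars, and paste with the identity of `W`.
Printed: "By the claim above and Lemma 1.2, there is no diffeomorphism between `V` and `V′`"
(the claim supplying, for every self-diffeomorphism of `N`, an extension over `X` isotopic to
the identity on `M = ∂W`, hence over `V′`); "we will choose `N` carefully so that all of its
self-diffeomorphisms extend over `V′`" (§2).
[cite: AkbulutRuberman2016, §3, proof of Thm. A ("By the claim above and Lemma 1.2 …") and §2] [cite: HirschDT1976, Ch. 8 §2, proof of Thm. 2.3] -/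
theorem akbulutRuberman2016_boundaryDiffeosExtend_holds :
    akbulutRuberman2016_boundaryDiffeosExtend.{u} := by
  intro W _ _ _ _ _ _ b f N _ _ _ X hX V' _ _ _ _ _ A' g
  -- the ends of `X` are closed `3`-manifolds
  haveI : CompactSpace b.carrier := X.compactSpace_of_inl
  haveI : T2Space b.carrier := X.t2Space_of_inl
  haveI : CompactSpace N := X.compactSpace_of_inr
  haveI : T2Space N := X.t2Space_of_inr
  -- the Claim
  obtain ⟨G, g', k, hGN, hGM, hg'g, hk⟩ := hX g
  -- Step 1: isotopies to diffeotopies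
  have h1 : Literature.Topology.FourManifolds.Diffeomorph.IsDiffeotopicToId k.symm :=
    isDiffeotopicToId_symm_of_isIsotopic_refl hk
  have h2 : Literature.Topology.FourManifolds.Diffeomorph.IsDiffeotopicToId (g'.symm.trans g) :=
    isDiffeotopicToId_symm_trans_of_isIsotopic hg'g
  -- Step 2: absorb the isotopies in a collar of `∂X`
  obtain ⟨Θ, hΘM, hΘN⟩ := X.exists_diffeomorph_apply_inl_apply_inr h1 h2
  have hG''M : ∀ m, (G.trans Θ) (X.inl m) = X.inl m := fun m => by
    rw [Diffeomorph.coe_trans, comp_apply, hGM, hΘM, Diffeomorph.symm_apply_apply]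
  have hG''N : ∀ y, (G.trans Θ) (X.inr y) = X.inr (g y) := fun y => by
    rw [Diffeomorph.coe_trans, comp_apply, hGN, hΘN, Diffeomorph.coe_trans, comp_apply,
      Diffeomorph.symm_apply_apply]
  -- Step 3: flatten near `∂W`
  obtain ⟨Ψ, hΨN, U, hUo, hU, hΨU⟩ := X.exists_diffeomorph_flatten_inl (G.trans Θ) hG''M
  have hG₂U : ∀ z ∈ U, ((G.trans Θ).trans Ψ) z = z := fun z hz => by
    rw [Diffeomorph.coe_trans, comp_apply]
    exact hΨU z hz
  have hG₂N : ∀ y, ((G.trans Θ).trans Ψ) (X.inr y) = X.inr (g y) := fun y => by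
    rw [Diffeomorph.coe_trans, comp_apply, hG''N, hΨN]
  -- Step 4: paste with the identity of `W`
  obtain ⟨Φ, hΦX, -⟩ := A'.exists_diffeomorph_apply_jX_eq ((G.trans Θ).trans Ψ) hUo hU hG₂U
  refine ⟨Φ, fun y => ?_⟩
  change Φ (A'.jX (X.inr y)) = A'.jX (X.inr (g y))
  rw [hΦX, hG₂N]

/-! ### Corollaries: one leaf fewer below Thm. A and the barrier -/

/-- **The pair `V`, `V′` of §§2–3 from three parts** ((S) is proved above): for every compact
contractible `W` with boundary datum `b` and every self-diffeomorphism `f` of `∂W`, the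
symmetry-killing cobordism (C), the attachment fact (G) and relative exoticness (R) give compact
contractible smooth 4-manifolds `V = W ∪_{id} X`, `V′ = W ∪_f X` with boundary data `bV`, `bV′`
and an identification `ν : ∂V ≅ ∂V′` (both are `N`; `ν = id`) such that every self-diffeomorphism
of `∂V′` extends to a self-diffeomorphism of `V′` ("all of its self-diffeomorphisms extend over
`V′`", §2) and a diffeomorphism `V ≅ V′` compatible with `ν` on the boundary exists only if `f`
extends to a self-diffeomorphism of `W` ("`V′` is exotic relative to the identity marking on
`∂V′ = N`", §§2–3) — the conjunction of what §3 establishes about `V`, `V′` before invoking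
Lemma 1.2, written out (it is a theorem of the leaves (C), (G), (R), (S) of the DAG of Thm. A,
`akbulutRuberman2016_construction_contractible_of_parts`, not a named fact).
[cite: AkbulutRuberman2016, §2 (paragraph after Lemma 2.3) and §3 (proof of Thm. A)] -/
theorem akbulutRuberman2016_construction_contractible_of_three_parts
    (hC : akbulutRuberman2016_symmetryKillingCobordism.{u})
    (hG : exists_cobordismAttachment.{u})
    (hR : akbulutRuberman2016_relativelyExotic.{u})
    (W : Type u) [TopologicalSpace W] [T2Space W] [SecondCountableTopology W]
    [ChartedSpace (EuclideanHalfSpace 4) W] [IsManifold (𝓡∂ 4) ∞ W] [CompactSpace W]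
    [ContractibleSpace W] (b : BoundaryData (𝓡∂ 4) W (𝓡 3))
    (f : b.carrier ≃ₘ⟮𝓡 3, 𝓡 3⟯ b.carrier) :
    ∃ (V V' : Type u) (_ : TopologicalSpace V) (_ : T2Space V) (_ : SecondCountableTopology V)
      (_ : ChartedSpace (EuclideanHalfSpace 4) V) (_ : IsManifold (𝓡∂ 4) ∞ V) (_ : CompactSpace V)
      (_ : ContractibleSpace V)
      (_ : TopologicalSpace V') (_ : T2Space V') (_ : SecondCountableTopology V')
      (_ : ChartedSpace (EuclideanHalfSpace 4) V') (_ : IsManifold (𝓡∂ 4) ∞ V')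
      (_ : CompactSpace V') (_ : ContractibleSpace V')
      (bV : BoundaryData (𝓡∂ 4) V (𝓡 3)) (bV' : BoundaryData (𝓡∂ 4) V' (𝓡 3))
      (ν : bV.carrier ≃ₘ⟮𝓡 3, 𝓡 3⟯ bV'.carrier),
      (∀ g : bV'.carrier ≃ₘ⟮𝓡 3, 𝓡 3⟯ bV'.carrier, ExtendsToDiffeomorph bV' g) ∧
      ∀ Φ : V ≃ₘ⟮𝓡∂ 4, 𝓡∂ 4⟯ V', (∀ z, Φ (bV.incl z) = bV'.incl (ν z)) →
        ExtendsToDiffeomorph b f :=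
  akbulutRuberman2016_construction_contractible_of_parts hC hG hR
    akbulutRuberman2016_boundaryDiffeosExtend_holds W b f

/-- **Thm. A (contractible `W`) from (C) and (R)** (the attachment fact (G) is the tree's theorem
`exists_cobordismAttachment_holds`, (S) is proved above).
[cite: AkbulutRuberman2016, Thm. A and §3] -/
theorem akbulutRuberman2016_theoremA_contractible_of_two_parts
    (hC : akbulutRuberman2016_symmetryKillingCobordism.{u})
    (hR : akbulutRuberman2016_relativelyExotic.{u}) :
    akbulutRuberman2016_theoremA_contractible.{u} :=
  akbulutRuberman2016_theoremA_contractible_of_parts hC exists_cobordismAttachment_holds hR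
    akbulutRuberman2016_boundaryDiffeosExtend_holds

/-- **The barrier `ContractibleBarrierFour` from a cork, (C), (R) and Freedman–Quinn** — the
leaves of the printed proof of Thm. B that remain named facts after this file.
[cite: AkbulutRuberman2016, Thm. B and its proof (§3)] -/
theorem contractibleBarrierFour_of_cork_symmetryKilling_relativelyExotic_freedmanQuinn
    (hK : akbulut1991_mazurCork.{u})
    (hC : akbulutRuberman2016_symmetryKillingCobordism.{u})
    (hR : akbulutRuberman2016_relativelyExotic.{u})
    (hF : freedmanQuinn1990_homeomorph_extends_contractible.{u}) :
    ContractibleBarrierFour.{u} :=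
  contractibleBarrierFour_of_parts hK hC exists_cobordismAttachment_holds hR
    akbulutRuberman2016_boundaryDiffeosExtend_holds hF

end Literature.Barriers.SmoothPoincare4

end
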